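import Mathlib
import Summits.Ventures.PercRepro2.Defs
import Summits.Ventures.PercRepro2.Graph
import Summits.Ventures.PercRepro2.Events
import Summits.Ventures.PercRepro2.Harris
import Summits.Ventures.PercRepro2.PinnedLaw
import Summits.Ventures.PercRepro2.XWForm

/-!
# (XW) on the complete bipartite graph `K_{2,4}`: the graph, its connectivity as a Boolean
formula, the bit encodings (PercRepro2, p2 g25)

`K_{2,4}` on `Fin 6`: the **leaves** `0, 1, 2, 3` (the four marks) and the **hubs** `4, 5`; the edge
`2i` joins the leaf `i` to the hub `4`, the edge `2i + 1` joins it to the hub `5`.  This is the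
two-hub member `H₂` of the hub family (every non-mark adjacent to the marks only) — a
2-connected graph on SIX vertices, beyond the reach `≤ 5 vertices` of the certificate method for
all graphs (P2-G24-XWGEN.md §8, §12); for this graph the coefficientwise certificate holds
(own census: all `3^8` cells, 0 negative colouring sums, mining/p2/g25/bern.py).

Connectivity is a short Boolean formula (`tabBit`): two leaves are connected through a common
open hub, or through both hubs with a **bridge** (a leaf open to both hubs); a leaf and a hub
directly or through the other hub and a bridge; the two hubs through a bridge.  `conn_iff_tab`
proves it equal to `Conn k24` by the walk induction (paths have length `≤ 4`).  Own work,
modelled on XWKFiveTab.lean; standard axioms.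
-/

namespace Summit.Ventures.PercRepro2

namespace XWKTwoFour

/-! ## `K_{2,4}` and its connectivity as a Boolean formula -/

/-- `K_{2,4}`: leaves `0..3`, hubs `4, 5`; edge `2i` = `(i, 4)`, edge `2i + 1` = `(i, 5)`. -/
def k24 : Fin 8 → Sym2 (Fin 6) :=
  ![s(0, 4), s(0, 5), s(1, 4), s(1, 5), s(2, 4), s(2, 5), s(3, 4), s(3, 5)]

/-- The edge index of a pair of vertices (`8`, a non-bit, for non-edges). -/
def edgeIdx (u v : Fin 6) : ℕ :=
  if u.val < 4 ∧ v.val = 4 then 2 * u.val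
  else if u.val < 4 ∧ v.val = 5 then 2 * u.val + 1
  else if v.val < 4 ∧ u.val = 4 then 2 * v.val
  else if v.val < 4 ∧ u.val = 5 then 2 * v.val + 1
  else 8

/-- The state of the edge between `u` and `v` in the bit pattern `X`. -/
def edgeBit (X : ℕ) (u v : Fin 6) : Bool := X.testBit (edgeIdx u v)

/-- The leaf `i` is open to the hub `4` in the pattern `X`. -/
def at4 (X : ℕ) (i : ℕ) : Bool := X.testBit (2 * i)

/-- The leaf `i` is open to the hub `5` in the pattern `X`. -/
def at5 (X : ℕ) (i : ℕ) : Bool := X.testBit (2 * i + 1)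

/-- Some leaf is open to both hubs. -/
def bridge (X : ℕ) : Bool :=
  (at4 X 0 && at5 X 0) || (at4 X 1 && at5 X 1) || (at4 X 2 && at5 X 2) || (at4 X 3 && at5 X 3)

/-- Connectivity on `K_{2,4}` as a Boolean formula. -/
def tabBit (X : ℕ) (u v : Fin 6) : Bool :=
  if u = v then true
  else if u.val < 4 ∧ v.val < 4 then
    (at4 X u.val && at4 X v.val) || (at5 X u.val && at5 X v.val) ||
      (((at4 X u.val && at5 X v.val) || (at5 X u.val && at4 X v.val)) && bridge X)
  else if u.val < 4 ∧ v.val = 4 then at4 X u.val || (at5 X u.val && bridge X)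
  else if u.val < 4 ∧ v.val = 5 then at5 X u.val || (at4 X u.val && bridge X)
  else if v.val < 4 ∧ u.val = 4 then at4 X v.val || (at5 X v.val && bridge X)
  else if v.val < 4 ∧ u.val = 5 then at5 X v.val || (at4 X v.val && bridge X)
  else bridge X

/-! ## Bit encodings of configurations and edge sets -/

/-- The configuration with the bits of `k`. -/
def cfg (k : ℕ) : Config (Fin 8) := fun e => k.testBit e.val

/-- The bit encoding of a configuration. -/
def enc (ω : Config (Fin 8)) : ℕ := ∑ e : Fin 8, if ω e then 2 ^ e.val else 0

/-- The bit encoding of an edge set (through its indicator configuration). -/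
def maskOf (F : Finset (Fin 8)) : ℕ := enc fun e => decide (e ∈ F)

/-- `cfg` inverts `enc`. -/
lemma cfg_enc : ∀ ω : Config (Fin 8), cfg (enc ω) = ω := by
  decide +kernel

/-- `enc` inverts `cfg` below `256`. -/
lemma enc_cfg : ∀ k < 256, enc (cfg k) = k := by
  decide +kernel

/-- The encoding is below `256`. -/
lemma enc_lt : ∀ ω : Config (Fin 8), enc ω < 256 := by
  decide +kernel

/-- A bit of an encoding is the configuration's value. -/
lemma testBit_enc (ω : Config (Fin 8)) (e : Fin 8) : (enc ω).testBit e.val = ω e := by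
  have h := congrFun (cfg_enc ω) e
  simpa [cfg] using h

/-- Membership in an edge set through its mask. -/
lemma mem_iff_testBit (F : Finset (Fin 8)) (e : Fin 8) :
    e ∈ F ↔ (maskOf F).testBit e.val := by
  unfold maskOf
  rw [testBit_enc]
  simp

/-- The mask of an edge set is below `256`. -/
lemma maskOf_lt (F : Finset (Fin 8)) : maskOf F < 256 := enc_lt _

/-- The configurations are the bit patterns of `Fin 256`. -/
def cfgEquiv : Fin 256 ≃ Config (Fin 8) where
  toFun k := cfg k.val
  invFun ω := ⟨enc ω, enc_lt ω⟩
  left_inv k := Fin.ext (enc_cfg k.val k.isLt)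
  right_inv ω := cfg_enc ω

/-! ## The formula is connectivity -/

/-- An open edge between `u` and `v` is an open-adjacency witness. -/
lemma exists_of_edgeBit : ∀ (ω : Config (Fin 8)) (u v : Fin 6), edgeBit (enc ω) u v = true →
    ∃ e : Fin 8, ω e = true ∧ k24 e = s(u, v) := by
  decide +kernel

/-- An open-adjacency witness is an open edge. -/
lemma edgeBit_of_exists : ∀ (ω : Config (Fin 8)) (u v : Fin 6),
    (∃ e : Fin 8, ω e = true ∧ k24 e = s(u, v)) → edgeBit (enc ω) u v = true := by
  decide +kernel

/-- The formula is reflexive. -/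
lemma tab_refl : ∀ X < 256, ∀ u : Fin 6, tabBit X u u = true := by
  decide +kernel

/-- The formula absorbs an open edge at the end. -/
lemma tab_tail : ∀ X < 256, ∀ u v w : Fin 6,
    tabBit X u v = true → edgeBit X v w = true → tabBit X u w = true := by
  decide +kernel

/-- An open path of length `≤ 4` between `u` and `v`, as a Boolean. -/
def pathB (X : ℕ) (u v : Fin 6) : Bool :=
  decide (u = v) || edgeBit X u v ||
    (List.finRange 6).any (fun w => edgeBit X u w && edgeBit X w v) ||
    (List.finRange 6).any (fun w => (List.finRange 6).any (fun w' =>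
      edgeBit X u w && edgeBit X w w' && edgeBit X w' v)) ||
    (List.finRange 6).any (fun w => (List.finRange 6).any (fun w' => (List.finRange 6).any
      (fun w'' => edgeBit X u w && edgeBit X w w' && edgeBit X w' w'' && edgeBit X w'' v)))

/-- A formula connection is an open path of length `≤ 4`. -/
lemma tab_path : ∀ X < 256, ∀ u v : Fin 6, tabBit X u v = true → pathB X u v = true := by
  decide +kernel

/-- `pathB` unfolds to the existence of an open path of length `≤ 4`. -/
lemma pathB_spec {X : ℕ} {u v : Fin 6} (h : pathB X u v = true) :
    u = v ∨ edgeBit X u v = true ∨ (∃ w, edgeBit X u w = true ∧ edgeBit X w v = true) ∨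
      (∃ w w', edgeBit X u w = true ∧ edgeBit X w w' = true ∧ edgeBit X w' v = true) ∨
      ∃ w w' w'', edgeBit X u w = true ∧ edgeBit X w w' = true ∧ edgeBit X w' w'' = true ∧
        edgeBit X w'' v = true := by
  simp only [pathB, Bool.or_eq_true, decide_eq_true_eq, List.any_eq_true, List.mem_finRange,
    true_and, Bool.and_eq_true, and_assoc] at h
  rcases h with (((h | h) | ⟨w, h1, h2⟩) | ⟨w, w', h1, h2, h3⟩) | ⟨w, w', w'', h1, h2, h3, h4⟩
  · exact Or.inl h
  · exact Or.inr (Or.inl h)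
  · exact Or.inr (Or.inr (Or.inl ⟨w, h1, h2⟩))
  · exact Or.inr (Or.inr (Or.inr (Or.inl ⟨w, w', h1, h2, h3⟩)))
  · exact Or.inr (Or.inr (Or.inr (Or.inr ⟨w, w', w'', h1, h2, h3, h4⟩)))

/-- An open edge connects. -/
lemma conn_of_edgeBit {ω : Config (Fin 8)} {u v : Fin 6} (h : edgeBit (enc ω) u v = true) :
    Conn k24 ω u v := by
  obtain ⟨e, he, hk⟩ := exists_of_edgeBit ω u v h
  exact conn_of_openAdj ⟨e, he, hk⟩

/-- **The formula is connectivity on `K_{2,4}`.** -/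
theorem conn_iff_tab (ω : Config (Fin 8)) (u v : Fin 6) :
    Conn k24 ω u v ↔ tabBit (enc ω) u v = true := by
  constructor
  · intro h
    unfold Conn at h
    rw [SimpleGraph.reachable_iff_reflTransGen] at h
    induction h with
    | refl => exact tab_refl (enc ω) (enc_lt ω) u
    | tail _ hadj ih =>
      rw [openGraph_adj] at hadj
      exact tab_tail (enc ω) (enc_lt ω) _ _ _ ih (edgeBit_of_exists ω _ _ hadj.2)
  · intro h
    rcases pathB_spec (tab_path (enc ω) (enc_lt ω) u v h) with rfl | h | ⟨w, h1, h2⟩ |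
      ⟨w, w', h1, h2, h3⟩ | ⟨w, w', w'', h1, h2, h3, h4⟩
    · exact conn_refl k24 ω u
    · exact conn_of_edgeBit h
    · exact conn_trans (conn_of_edgeBit h1) (conn_of_edgeBit h2)
    · exact conn_trans (conn_of_edgeBit h1) (conn_trans (conn_of_edgeBit h2) (conn_of_edgeBit h3))
    · exact conn_trans (conn_of_edgeBit h1) (conn_trans (conn_of_edgeBit h2)
        (conn_trans (conn_of_edgeBit h3) (conn_of_edgeBit h4)))

/-- Connectivity of a configuration, as a Boolean. -/
def connB (ω : Config (Fin 8)) (u v : Fin 6) : Bool := tabBit (enc ω) u v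

/-- Membership in a connection event of `K_{2,4}`, as a Boolean. -/
lemma mem_connEvent_iff (ω : Config (Fin 8)) (u v : Fin 6) :
    ω ∈ connEvent k24 u v ↔ connB ω u v = true :=
  conn_iff_tab ω u v

end XWKTwoFour

end Summit.Ventures.PercRepro2
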